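import Summits.QuantumFields.YangMills.Theorems.FluctuationComparisonRegPrIntLS2BetaSqrtGaugeStageSBoxBlock
import Summits.QuantumFields.YangMills.Theorems.FluctuationComparisonRegPrIntLS2BetaSlowBoxShellConeCentre
import Summits.QuantumFields.YangMills.Theorems.FluctuationComparisonRegPrIntLS2BetaSqrtGaugeFill3Tools
import HarnessLib

/-!
# S2β · D-GUARD ∕ (BG∞) — FILL₃: THE STAGE-3 FILLING LETTER OF px19 g25's `hSec_of_fillings`, DISCHARGED ((F3) — the last brick of the S-lane box road):
# `fill3 : ∀ E, ∃ A ρ₀, ∀ P (d = 3) ρ ≥ ρ₀ (8ρ ≤ N) (n s : per-axis box, ρ ≤ n κ ∧ 3·n κ ≤ 4ρ+3) ψ ε, ∃ W, (W = ψ on box ∩ shell) ∧ (ψ ε-slow on the shell with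
# ερ ≤ E ⟹ W (A∕ρ)-slow on every bond of the box)` — `h₃` VERBATIM, by the box cone ✓p840472 (R2-S) at the centre of ✓p840496 (B3-S)′ read on the block by ✓∕⧗(L-S)′,
# the longest axis named first, with the numerics of ✓∕⧗(F3a)

Cell `ym3-torus` (YM ladder rung R3 = continuum `SU(2)` Yang–Mills on the three-torus at fixed lattice data — a RUNG: NOT d = 4, NOT infinite volume,
NOT a mass gap, NOT Clay).  Width seat «width 8» `ym3-torus-px8` (gen 28, toron∕flux lineage ✓p826411 → px17 (W1) ✓p837971), FREE px helper on crux
`stmt-QuantumFields-20520`; `--kind proof --supports stmt-QuantumFields-20520 --as helper`, count-neutral, DEFINITION-FREE (0 `def`, 0 `instance`, 0 `notation`,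
0 `sorry`, default heartbeats).  px19 g25 02:55:11Z: «`hBG` ⟸ `hSec` (✓p840037) ⟸ FILL₁ ∧ FILL₂ ∧ FILL₃ … FILL₃ ← (L-S)(′) + (B3-S) — px8»; 02:58:38Z «agreed».

WHY.  `h₃` is the stage-3 input of the (L-Σ) composition (✓∕⧗`…SectionsOfFillings` §7): on a class-3 block (a box `{0..n α} × {0..n β} × {0..n γ}` in the offset
coordinates of ✓p839889, sides in `[ρ, (4ρ+3)∕3]`), the datum prescribed on the shell by the lower stages must be extended inside with steps `≤ A∕ρ`.  The
extension is the CONE of [Balaban1985RegularSpaces]-style small-field geometry: centre `a` from the slow shell ((B3-S)′ `exists_boxCentre`, nets + packing), box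
operator `Wb` from (R2-S) `exists_coneOnBox … a`, section `W x := Wb (box datum of t(x)) (t(x) α, t(x) β, t(x) γ)` read by (L-S)′ (`stageS_shell_eq` for clause (i),
`dist1_stageS_inbox_le` for the steps); the `∃ W` is chosen by cases on the slow premise (the cone if it holds — its cap needs the premise —, `ψ` itself otherwise,
clause (i) holding either way); the offset datum `φ u := ψ (s + u)` carries the premise's bond letters to (L-S)′'s offset letter `hstep` through the bond
`⟨s + u, κ⟩` ((F3a) §2); the numerics are (F3a) §1 with `D := max E 1`, `r := 1∕(7200 D²)`, `L := ⌈7D∕r⌉₊`, `m := ρ∕L + 1`, `A := 12π²D∕r + 6π`, `ρ₀ := 2`.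

WHAT IS PROVED (sorry-free).
* §1 ★★ `fill3_core` — the filling on one box with the axes named (`α` the longest: `n β, n γ ≤ n α`), numerics as hypotheses (`E ≤ D`, `1 ≤ D`, `r = 1∕(7200D²)`,
  `7D∕r ≤ L ≤ 8D∕r`, `1 ≤ L`, `ρ ≥ 2`): `∃ W, (i) ∧ (slow ⟹ steps ≤ (12π²D∕r + 6π)∕ρ)`.
* §2 ★★★ `fill3` — `h₃` of `hSec_of_fillings` VERBATIM (`∀ E, ∃ A ρ₀, …`): the three axes `⟨0⟩, ⟨1⟩, ⟨2⟩` of `Fin P.d` (`P.d = 3`), the longest named first by a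
  three-way case split, then `fill3_core`.  The (L-Σ) assembler writes `hSec_of_fillings h₁ h₂ fill3`.

HONEST SCOPE.  Composition of landed∕pending sphere∕lattice geometry and arithmetic (✓p839993 S2, ✓p840009 S0, ✓p840187, ✓p840271, ✓p840472 (R2-S), ✓p840496
(B3-S)′, (L-S)′, (F3a), ✓p840086, ✓p839220, ✓p839889); no renormalisation group; nothing of Bałaban's analysis is asserted or proved ([Balaban1985RegularSpaces]
Lemma 1 p.79, Thm 2 p.83 — local small gauges — the torus-global `√θ` law is NOT in print).  THIS FILE PROVES ONE OF THE THREE FILLING LETTERS; `hSec` follows only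
with FILL₁ (px19) and FILL₂ (px5) and the landing of `…SectionsOfFillings`; `hBG` then by ✓p840037; until then `hSec`∕`hBG`, D-GUARD's `hsupp^{≥J₀}`, GAP♯∘
(`stub_uniformFibreGapOrbit`; registry v11 UNTOUCHED), the five registered stubs (0∕5), S2β, 20520, 19936, 19200, `YM3TorusSU2` are NOT proved; no registered stub is
closed; rung R3 = `SU(2)` YM₃ on T³ at fixed lattice data — NOT d = 4, NOT infinite volume, NOT a mass gap, NOT Clay; the Yang–Mills mass gap is NOT proved.
Axioms standard.

References: T. Bałaban, CMP **99** (1985) 75–102 [Balaban1985RegularSpaces] (Lemma 1 p.79, Thm 2 p.83).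
-/

set_option autoImplicit false

noncomputable section

namespace Summit.QuantumFields.YangMills.Theorems.FluctuationComparisonRegPrIntLS2BetaSqrtGaugeFill3

open scoped Real
open Literature.MathematicalPhysics.QuantumLattice (su2Quat)
open Literature.MathematicalPhysics.QuantumFieldTheory.Balaban1983to89
open T4CubeChartGnomonic (SU2)
open T4ExpWindowSmallField (logVec)
open Summit.QuantumFields.YangMills.Theorems.FluctuationComparisonRegPrIntLS2BetaConeOnBox (exists_coneOnBox)
open Summit.QuantumFields.YangMills.Theorems.FluctuationComparisonRegPrIntLS2BetaSqrtGaugeStageSBoxBlock (stageS_shell_eq dist1_stageS_inbox_le)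
open Summit.QuantumFields.YangMills.Theorems.FluctuationComparisonRegPrIntLS2BetaSlowBoxShellConeCentre (exists_boxCentre)
open Summit.QuantumFields.YangMills.Theorems.FluctuationComparisonRegPrIntLS2BetaSqrtGaugeFill3Tools
open Summit.QuantumFields.YangMills.Theorems.FluctuationComparisonRegPrIntLS2BetaBlockOffsetCoordinates (offset_tgt_dir)

/-! ## §1 The filling on one box, the longest axis named first -/

/-- ★★ **FILL₃ ON ONE BOX (axes named, `α` the longest)**: for three pairwise distinct axes covering all directions, sides `n β, n γ ≤ n α` obeying the side law at
scale `ρ ≥ 2` with `8ρ ≤ N`, the numerics `r = 1∕(7200 D²)`, `7D∕r ≤ L ≤ 8D∕r`, and any datum `ψ`, scale `ε`: a section `W` equal to `ψ` on the box's shell and —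
if `ψ` is `ε`-slow on the shell with `ερ ≤ E ≤ D` — of step `≤ (12π²D∕r + 6π)∕ρ` on every bond of the box. [cite: Balaban1985RegularSpaces, Thm 2 p.83] -/
theorem fill3_core {P : Params} {α β γ : Fin P.d} (hαβ : α ≠ β) (hαγ : α ≠ γ) (hβγ : β ≠ γ) (htri : ∀ κ : Fin P.d, κ = α ∨ κ = β ∨ κ = γ)
    {E D r : ℝ} {L : ℕ} (hED : E ≤ D) (hD : 1 ≤ D) (hr : r = 1 / (7200 * D ^ 2)) (hL7 : 7 * D / r ≤ (L : ℝ)) (hL8 : (L : ℝ) ≤ 8 * D / r)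
    (hL1 : 1 ≤ L) {ρ : ℕ} (hρ : 2 ≤ ρ) (hρN : 8 * ρ ≤ P.sitesPerDir 0) (n s : Fin P.d → ℕ) (hn : ∀ κ, ρ ≤ n κ ∧ 3 * n κ ≤ 4 * ρ + 3)
    (hβα : n β ≤ n α) (hγα : n γ ≤ n α) (ψ : Site P 0 → SU2) (ε : ℝ) :
    ∃ W : Site P 0 → SU2,
      (∀ x : Site P 0, (∀ κ, (x κ - ((s κ : ℕ) : ZMod (P.sitesPerDir 0))).val ≤ n κ) →
        (∃ κ, (x κ - ((s κ : ℕ) : ZMod (P.sitesPerDir 0))).val = 0 ∨ (x κ - ((s κ : ℕ) : ZMod (P.sitesPerDir 0))).val = n κ) → W x = ψ x) ∧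
      ((0 ≤ ε ∧ ε * ρ ≤ E ∧ ∀ b : PBond P 0, (∀ κ, (b.src κ - ((s κ : ℕ) : ZMod (P.sitesPerDir 0))).val ≤ n κ) →
          (∀ κ, (b.tgt κ - ((s κ : ℕ) : ZMod (P.sitesPerDir 0))).val ≤ n κ) →
          (∃ κ, (b.src κ - ((s κ : ℕ) : ZMod (P.sitesPerDir 0))).val = 0 ∨ (b.src κ - ((s κ : ℕ) : ZMod (P.sitesPerDir 0))).val = n κ) →
          (∃ κ, (b.tgt κ - ((s κ : ℕ) : ZMod (P.sitesPerDir 0))).val = 0 ∨ (b.tgt κ - ((s κ : ℕ) : ZMod (P.sitesPerDir 0))).val = n κ) →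
          dist1 (ψ b.src * (ψ b.tgt)⁻¹) ≤ ε) →
        ∀ b : PBond P 0, (∀ κ, (b.src κ - ((s κ : ℕ) : ZMod (P.sitesPerDir 0))).val ≤ n κ) →
          (∀ κ, (b.tgt κ - ((s κ : ℕ) : ZMod (P.sitesPerDir 0))).val ≤ n κ) →
          dist1 (W b.src * (W b.tgt)⁻¹) ≤ (12 * π ^ 2 * D / r + 6 * π) / ρ) := by
  classical
  obtain ⟨hr0, -, hrπ, hrπ3, hrπ2⟩ := radius_facts hD hr
  have hN8 : ∀ κ, n κ + 1 < P.sitesPerDir 0 := fun κ => by have := hn κ; omega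
  have hn2 : ∀ κ, 2 ≤ n κ := fun κ => le_trans hρ (hn κ).1
  have hnαβ : n α ≤ 2 * n β := by have := hn α; have := hn β; omega
  have hnαγ : n α ≤ 2 * n γ := by have := hn α; have := hn γ; omega
  by_cases hslow : (0 ≤ ε ∧ ε * ρ ≤ E ∧ ∀ b : PBond P 0, (∀ κ, (b.src κ - ((s κ : ℕ) : ZMod (P.sitesPerDir 0))).val ≤ n κ) →
      (∀ κ, (b.tgt κ - ((s κ : ℕ) : ZMod (P.sitesPerDir 0))).val ≤ n κ) →
      (∃ κ, (b.src κ - ((s κ : ℕ) : ZMod (P.sitesPerDir 0))).val = 0 ∨ (b.src κ - ((s κ : ℕ) : ZMod (P.sitesPerDir 0))).val = n κ) →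
      (∃ κ, (b.tgt κ - ((s κ : ℕ) : ZMod (P.sitesPerDir 0))).val = 0 ∨ (b.tgt κ - ((s κ : ℕ) : ZMod (P.sitesPerDir 0))).val = n κ) →
      dist1 (ψ b.src * (ψ b.tgt)⁻¹) ≤ ε)
  swap
  · exact ⟨ψ, fun x _ _ => rfl, fun h => absurd h hslow⟩
  obtain ⟨hε0, hεE, hbond⟩ := hslow
  have hρ0 : 0 < ρ := by omega
  have hεD : ε * ρ ≤ D := hεE.trans hED
  -- the offset datum of the box
  obtain ⟨φ, hφ⟩ : ∃ φ : (Fin P.d → ℕ) → SU2,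
      ∀ u, φ u = ψ (fun κ => ((s κ : ℕ) : ZMod (P.sitesPerDir 0)) + ((u κ : ℕ) : ZMod (P.sitesPerDir 0))) := ⟨_, fun _ => rfl⟩
  -- its per-bond shell letter in offset-vector currency (for every `t`: at `d = 3` every `u` is in the box of `t`)
  have hstep : ∀ t : Fin P.d → ℕ, ∀ u : Fin P.d → ℕ, ∀ κ : Fin P.d, (κ = α ∨ κ = β ∨ κ = γ) →
      Function.update (Function.update (Function.update u α (t α)) β (t β)) γ (t γ) = t →
      u α ≤ n α → u β ≤ n β → u γ ≤ n γ → (u α = 0 ∨ u α = n α ∨ u β = 0 ∨ u β = n β ∨ u γ = 0 ∨ u γ = n γ) →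
      Function.update u κ (u κ + 1) α ≤ n α → Function.update u κ (u κ + 1) β ≤ n β → Function.update u κ (u κ + 1) γ ≤ n γ →
      (Function.update u κ (u κ + 1) α = 0 ∨ Function.update u κ (u κ + 1) α = n α ∨
        Function.update u κ (u κ + 1) β = 0 ∨ Function.update u κ (u κ + 1) β = n β ∨
        Function.update u κ (u κ + 1) γ = 0 ∨ Function.update u κ (u κ + 1) γ = n γ) →
      dist1 (φ u * (φ (Function.update u κ (u κ + 1)))⁻¹) ≤ ε := by
    intro t u κ _ _ huα huβ huγ hub hvα hvβ hvγ hvb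
    have hule : ∀ κ', u κ' ≤ n κ' := fun κ' => by
      rcases htri κ' with h | h | h <;> rw [h] <;> assumption
    have hvle : ∀ κ', Function.update u κ (u κ + 1) κ' ≤ n κ' := fun κ' => by
      rcases htri κ' with h | h | h <;> rw [h] <;> assumption
    have hult : ∀ κ', u κ' < P.sitesPerDir 0 := fun κ' => by have := hule κ'; have := hN8 κ'; omega
    have hvlt : ∀ κ', Function.update u κ (u κ + 1) κ' < P.sitesPerDir 0 := fun κ' => by
      have := hvle κ'; have := hN8 κ'; omega
    -- the bond from the site of `u` in direction `κ`
    have hsrc : ∀ κ', ((⟨fun κ' => ((s κ' : ℕ) : ZMod (P.sitesPerDir 0)) + ((u κ' : ℕ) : ZMod (P.sitesPerDir 0)), κ⟩ : PBond P 0).src κ' -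
        ((s κ' : ℕ) : ZMod (P.sitesPerDir 0))).val = u κ' := fun κ' => offset_natCast_add s u κ' (hult κ')
    have htgt' := tgt_natCast_add (P := P) (j := 0) s u κ
    have htgt : ∀ κ', ((⟨fun κ' => ((s κ' : ℕ) : ZMod (P.sitesPerDir 0)) + ((u κ' : ℕ) : ZMod (P.sitesPerDir 0)), κ⟩ : PBond P 0).tgt κ' -
        ((s κ' : ℕ) : ZMod (P.sitesPerDir 0))).val = Function.update u κ (u κ + 1) κ' := fun κ' => by
      rw [htgt']; exact offset_natCast_add s _ κ' (hvlt κ')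
    have h := hbond ⟨fun κ' => ((s κ' : ℕ) : ZMod (P.sitesPerDir 0)) + ((u κ' : ℕ) : ZMod (P.sitesPerDir 0)), κ⟩
      (fun κ' => by rw [hsrc]; exact hule κ') (fun κ' => by rw [htgt]; exact hvle κ')
      (by
        rcases hub with hb | hb | hb | hb | hb | hb
        · exact ⟨α, Or.inl (by rw [hsrc]; exact hb)⟩
        · exact ⟨α, Or.inr (by rw [hsrc]; exact hb)⟩
        · exact ⟨β, Or.inl (by rw [hsrc]; exact hb)⟩
        · exact ⟨β, Or.inr (by rw [hsrc]; exact hb)⟩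
        · exact ⟨γ, Or.inl (by rw [hsrc]; exact hb)⟩
        · exact ⟨γ, Or.inr (by rw [hsrc]; exact hb)⟩)
      (by
        rcases hvb with hb | hb | hb | hb | hb | hb
        · exact ⟨α, Or.inl (by rw [htgt]; exact hb)⟩
        · exact ⟨α, Or.inr (by rw [htgt]; exact hb)⟩
        · exact ⟨β, Or.inl (by rw [htgt]; exact hb)⟩
        · exact ⟨β, Or.inr (by rw [htgt]; exact hb)⟩
        · exact ⟨γ, Or.inl (by rw [htgt]; exact hb)⟩
        · exact ⟨γ, Or.inr (by rw [htgt]; exact hb)⟩)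
    rw [htgt'] at h
    rw [hφ, hφ]
    exact h
  -- the centre (net step `m := ρ ∕ L + 1`), at `t₀ := 0`
  have hrad := patchRadius_le hD hr0 hL7 hρ0 hε0 hεD
  have hcard := packing_lt_one hD hr hL1 hL8 hρ (hn α).2
  obtain ⟨a, hcap0⟩ := exists_boxCentre φ hαβ hαγ hβγ (fun _ => 0) (n α) (n β) (n γ) (ρ / L + 1) hβα hγα (Nat.succ_pos _)
    hε0 hr0.le hrπ3 (hstep fun _ => 0) hrad hcard
  have hcap : ∀ t u : Fin P.d → ℕ, Function.update (Function.update (Function.update u α (t α)) β (t β)) γ (t γ) = t →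
      u α ≤ n α → u β ≤ n β → u γ ≤ n γ → (u α = 0 ∨ u α = n α ∨ u β = 0 ∨ u β = n β ∨ u γ = 0 ∨ u γ = n γ) →
      ‖logVec (su2Quat (a⁻¹ * φ u))‖ ≤ π - r :=
    fun t u _ hα hβ hγ hb => hcap0 u (uuu_eq_of_tri hαβ hαγ hβγ htri u (fun _ => 0)) hα hβ hγ hb
  -- the box cone and the section
  obtain ⟨Wb, hWb⟩ := exists_coneOnBox (n α) (n β) (n γ) (hn2 β) (hn2 γ) hβα hnαβ hγα hnαγ hr0 hrπ a
  obtain ⟨Wo, hWo⟩ : ∃ Wo : (Fin P.d → ℕ) → SU2, ∀ t, Wo t =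
      Wb (fun p => φ (Function.update (Function.update (Function.update t α p.1) β p.2.1) γ p.2.2)) (t α, t β, t γ) := ⟨_, fun _ => rfl⟩
  refine ⟨fun x => Wo (fun κ => (x κ - ((s κ : ℕ) : ZMod (P.sitesPerDir 0))).val), fun x hx hface => ?_, fun _ b hbs hbt => ?_⟩
  · -- (i) the shell agreement
    have hsh : (x α - ((s α : ℕ) : ZMod (P.sitesPerDir 0))).val = 0 ∨ (x α - ((s α : ℕ) : ZMod (P.sitesPerDir 0))).val = n α ∨
        (x β - ((s β : ℕ) : ZMod (P.sitesPerDir 0))).val = 0 ∨ (x β - ((s β : ℕ) : ZMod (P.sitesPerDir 0))).val = n β ∨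
        (x γ - ((s γ : ℕ) : ZMod (P.sitesPerDir 0))).val = 0 ∨ (x γ - ((s γ : ℕ) : ZMod (P.sitesPerDir 0))).val = n γ := by
      obtain ⟨κ, hκ⟩ := hface
      rcases htri κ with h | h | h <;> rw [h] at hκ
      · exact hκ.elim Or.inl (fun h' => Or.inr (Or.inl h'))
      · exact hκ.elim (fun h' => Or.inr (Or.inr (Or.inl h'))) (fun h' => Or.inr (Or.inr (Or.inr (Or.inl h'))))
      · exact hκ.elim (fun h' => Or.inr (Or.inr (Or.inr (Or.inr (Or.inl h'))))) (fun h' => Or.inr (Or.inr (Or.inr (Or.inr (Or.inr h')))))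
    show Wo (fun κ => (x κ - ((s κ : ℕ) : ZMod (P.sitesPerDir 0))).val) = ψ x
    rw [stageS_shell_eq φ a α β γ (n α) (n β) (n γ) r Wb hWb Wo hWo hαβ hαγ hβγ
      (fun κ => (x κ - ((s κ : ℕ) : ZMod (P.sitesPerDir 0))).val) (hx α) (hx β) (hx γ) hsh
      (hcap (fun κ => (x κ - ((s κ : ℕ) : ZMod (P.sitesPerDir 0))).val)), hφ, natCast_add_offset_eq s x]
  · -- the step bound on a bond of the box
    have hN : (b.src b.dir - ((s b.dir : ℕ) : ZMod (P.sitesPerDir 0))).val + 1 < P.sitesPerDir 0 := by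
      have := hbs b.dir; have := hN8 b.dir; omega
    have hdir1 : (b.tgt b.dir - ((s b.dir : ℕ) : ZMod (P.sitesPerDir 0))).val =
        (b.src b.dir - ((s b.dir : ℕ) : ZMod (P.sitesPerDir 0))).val + 1 := offset_tgt_dir s b rfl hN
    have htgt : (b.dir = α → (b.src α - ((s α : ℕ) : ZMod (P.sitesPerDir 0))).val + 1 ≤ n α) ∧
        (b.dir = β → (b.src β - ((s β : ℕ) : ZMod (P.sitesPerDir 0))).val + 1 ≤ n β) ∧
        (b.dir = γ → (b.src γ - ((s γ : ℕ) : ZMod (P.sitesPerDir 0))).val + 1 ≤ n γ) := by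
      refine ⟨fun h => ?_, fun h => ?_, fun h => ?_⟩ <;> subst h <;> rw [← hdir1] <;> exact hbt _
    have h := dist1_stageS_inbox_le φ a α β γ (n α) (n β) (n γ) r Wb hWb Wo hWo s hαβ hαγ hβγ b (htri b.dir) hN (hbs α) (hbs β) (hbs γ)
      htgt (hcap (fun κ => (b.src κ - ((s κ : ℕ) : ZMod (P.sitesPerDir 0))).val)) hε0
      (hstep (fun κ => (b.src κ - ((s κ : ℕ) : ZMod (P.sitesPerDir 0))).val))
    exact h.trans (stepConst_le hr0 hrπ2 hrπ hρ0 (hn α).1 hε0 hεD)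

/-! ## §2 FILL₃ -/

/-- ★★★ **FILL₃ — THE STAGE-3 FILLING LETTER OF ✓∕⧗`hSec_of_fillings`, DISCHARGED** (verbatim its `h₃`): for every input scale `E` there are `A := 12π²D∕r + 6π`
(`D := max E 1`, `r := 1∕(7200 D²)`) and `ρ₀ := 2` such that on every box of sides in `[ρ, (4ρ+3)∕3]` (per axis), a datum prescribed on the shell extends to a
section equal to it there, and `(A∕ρ)`-slow on every bond of the box whenever the datum is `ε`-slow on the shell with `ερ ≤ E`: the box cone of (R2-S) at the centre
of (B3-S)′ read on the block by (L-S)′, the longest axis named first. [cite: Balaban1985RegularSpaces, Lemma 1 p.79, Thm 2 p.83] -/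
theorem fill3 : ∀ E : ℝ, ∃ A : ℝ, ∃ ρ₀ : ℕ, ∀ (P : Params), P.d = 3 → ∀ ρ : ℕ, ρ₀ ≤ ρ → 8 * ρ ≤ P.sitesPerDir 0 →
      ∀ (n s : Fin P.d → ℕ), (∀ κ, ρ ≤ n κ ∧ 3 * n κ ≤ 4 * ρ + 3) →
      ∀ (ψ : Site P 0 → SU2) (ε : ℝ), ∃ W : Site P 0 → SU2,
        (∀ x : Site P 0, (∀ κ, (x κ - ((s κ : ℕ) : ZMod (P.sitesPerDir 0))).val ≤ n κ) →
          (∃ κ, (x κ - ((s κ : ℕ) : ZMod (P.sitesPerDir 0))).val = 0 ∨ (x κ - ((s κ : ℕ) : ZMod (P.sitesPerDir 0))).val = n κ) → W x = ψ x) ∧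
        ((0 ≤ ε ∧ ε * ρ ≤ E ∧ ∀ b : PBond P 0, (∀ κ, (b.src κ - ((s κ : ℕ) : ZMod (P.sitesPerDir 0))).val ≤ n κ) →
            (∀ κ, (b.tgt κ - ((s κ : ℕ) : ZMod (P.sitesPerDir 0))).val ≤ n κ) →
            (∃ κ, (b.src κ - ((s κ : ℕ) : ZMod (P.sitesPerDir 0))).val = 0 ∨ (b.src κ - ((s κ : ℕ) : ZMod (P.sitesPerDir 0))).val = n κ) →
            (∃ κ, (b.tgt κ - ((s κ : ℕ) : ZMod (P.sitesPerDir 0))).val = 0 ∨ (b.tgt κ - ((s κ : ℕ) : ZMod (P.sitesPerDir 0))).val = n κ) →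
            dist1 (ψ b.src * (ψ b.tgt)⁻¹) ≤ ε) →
          ∀ b : PBond P 0, (∀ κ, (b.src κ - ((s κ : ℕ) : ZMod (P.sitesPerDir 0))).val ≤ n κ) →
            (∀ κ, (b.tgt κ - ((s κ : ℕ) : ZMod (P.sitesPerDir 0))).val ≤ n κ) →
            dist1 (W b.src * (W b.tgt)⁻¹) ≤ A / ρ) := by
  intro E
  obtain ⟨D, hDdef⟩ : ∃ D : ℝ, D = max E 1 := ⟨_, rfl⟩
  have hED : E ≤ D := hDdef ▸ le_max_left _ _
  have hD : 1 ≤ D := hDdef ▸ le_max_right _ _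
  obtain ⟨r, hr⟩ : ∃ r : ℝ, r = 1 / (7200 * D ^ 2) := ⟨_, rfl⟩
  obtain ⟨hr0, hr1, -, -, -⟩ := radius_facts hD hr
  obtain ⟨L, hLdef⟩ : ∃ L : ℕ, L = ⌈7 * D / r⌉₊ := ⟨_, rfl⟩
  have hL7 : 7 * D / r ≤ (L : ℝ) := by rw [hLdef]; exact Nat.le_ceil _
  have hL8 : (L : ℝ) ≤ 8 * D / r := by
    have h1 : (L : ℝ) < 7 * D / r + 1 := by rw [hLdef]; exact Nat.ceil_lt_add_one (by positivity)
    have h2 : (1 : ℝ) ≤ D / r := by rw [le_div_iff₀ hr0]; linarith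
    have h3 : 8 * D / r = 7 * D / r + D / r := by ring
    linarith
  have hL1 : 1 ≤ L := by
    have h0 : (0 : ℝ) < L := lt_of_lt_of_le (by positivity) hL7
    have : 0 < L := by exact_mod_cast h0
    omega
  refine ⟨12 * π ^ 2 * D / r + 6 * π, 2, ?_⟩
  intro P hd ρ hρ hρN n s hn ψ ε
  -- the three axes
  obtain ⟨κ0, hκ0⟩ : ∃ κ0 : Fin P.d, (κ0 : ℕ) = 0 := ⟨⟨0, by omega⟩, rfl⟩
  obtain ⟨κ1, hκ1⟩ : ∃ κ1 : Fin P.d, (κ1 : ℕ) = 1 := ⟨⟨1, by omega⟩, rfl⟩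
  obtain ⟨κ2, hκ2⟩ : ∃ κ2 : Fin P.d, (κ2 : ℕ) = 2 := ⟨⟨2, by omega⟩, rfl⟩
  have h01 : κ0 ≠ κ1 := fun h => by have := congrArg Fin.val h; omega
  have h02 : κ0 ≠ κ2 := fun h => by have := congrArg Fin.val h; omega
  have h12 : κ1 ≠ κ2 := fun h => by have := congrArg Fin.val h; omega
  have htri : ∀ κ : Fin P.d, κ = κ0 ∨ κ = κ1 ∨ κ = κ2 := by
    intro κ
    have hκ : (κ : ℕ) < 3 := by rw [← hd]; exact κ.isLt
    rcases (by omega : (κ : ℕ) = 0 ∨ (κ : ℕ) = 1 ∨ (κ : ℕ) = 2) with h | h | h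
    · exact Or.inl (Fin.ext (by omega))
    · exact Or.inr (Or.inl (Fin.ext (by omega)))
    · exact Or.inr (Or.inr (Fin.ext (by omega)))
  -- the longest axis first
  by_cases hA : n κ1 ≤ n κ0 ∧ n κ2 ≤ n κ0
  · exact fill3_core h01 h02 h12 htri hED hD hr hL7 hL8 hL1 hρ hρN n s hn hA.1 hA.2 ψ ε
  by_cases hB : n κ0 ≤ n κ1 ∧ n κ2 ≤ n κ1
  · exact fill3_core (Ne.symm h01) h12 h02 (fun κ => (htri κ).elim (fun h => Or.inr (Or.inl h)) (fun h => h.elim Or.inl (fun h => Or.inr (Or.inr h))))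
      hED hD hr hL7 hL8 hL1 hρ hρN n s hn hB.1 hB.2 ψ ε
  · have hC : n κ0 ≤ n κ2 ∧ n κ1 ≤ n κ2 := by constructor <;> omega
    exact fill3_core (Ne.symm h02) (Ne.symm h12) h01 (fun κ => (htri κ).elim (fun h => Or.inr (Or.inl h)) (fun h => h.elim (fun h => Or.inr (Or.inr h)) Or.inl))
      hED hD hr hL7 hL8 hL1 hρ hρN n s hn hC.1 hC.2 ψ ε

end Summit.QuantumFields.YangMills.Theorems.FluctuationComparisonRegPrIntLS2BetaSqrtGaugeFill3

end
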